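import Literature.Computability.QuantumComplexity.LightCone
import Literature.Computability.QuantumComplexity.LightConeSimInit
import HarnessLib

/-!
# The light-cone simulator decides the language of a Clifford+T family: the integer test `W`

End-to-end correctness of the functional model of the light-cone simulator
(`LightConeSim.lean`, `LightConeSimInit.lean`) for a uniform oracle-free Clifford+`T` family `F`
(discharge of `Literature.Barriers.QuantumAdvantage.markovShi2008_cor15_anyOrder`, Markov–Shi 2008, Cor. 1.5,
decision form):

* `coneStep`, **`coneL gs S₀`** — the backward light cone computed on *lists* exactly as the
  machine does (wire list without duplicates, kept gate codes), and `coneL_spec`: it agrees with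
  the set-level `LightCone.cone` of `LightCone.lean` (same kept gates, same wire set, no
  duplicates);
* `decisionW F x hN` — the integer `W = 10A + 14B − 5·2^h` computed from the simulation of the cone
  of wire `0` of the `|x|`-th circuit on `|x 0^m⟩`, and **`decisionW_pos` / `decisionW_neg`**: if
  `F` accepts `x` with probability `≥ 2/3` then `W > 0`, if with probability `≤ 1/3` then `W < 0`.
  Chain: `acceptProbOn = acceptProb of the cone` (`acceptProb_eq_acceptProb_cone`, unitarity of
  Clifford+`T`) `= probAcc ω` of the kept gates (`prodZeta_omega`) `= 2^{-h}(A + √2 B)`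
  (`Represents` through `initState`/`runGates`, read-out), the conjugate run giving
  `2^{-h}(A − √2B) ∈ [0, 1]`, and the sign analysis `decision_sign`.

(Parallel line in the tree: `StateVectorDP.half_lt_probAcc_iff` is the exact sign test
`0 < a + b√2` for the function-table simulator, and
`Barriers/QuantumAdvantage/TensorNetworkContractionConeReduction.lean` reduces both typed forms of
Cor. 1.5 to the named machine fact `smallConeDecidable`; the present line proves the machine
directly, `LightConeMachine*.lean`, and does not go through that fact.)

## References

* I. L. Markov, Y. Shi, *Simulating quantum computation by contracting tensor networks*, SIAM J.
  Comput. 38 (2008), §1 Cor. 1.5 ("can be simulated deterministically", i.e. exact outcome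
  probabilities, hence the decision).
* L. M. Adleman, J. DeMarrais, M.-D. A. Huang, *Quantum computability*, SIAM J. Comput. 26 (1997),
  §6 Lemma 6.10 (integer sign tests for `ℤ[√2]/2^h`-valued acceptance probabilities).
* M. A. Nielsen, I. L. Chuang, *Quantum Computation and Quantum Information*, CUP 2010, Box 4.1.
-/

noncomputable section

namespace Literature.Computability.QuantumComplexity

open _root_.Computability Complexity Cryptography Matrix

namespace LightCone

variable {N : ℕ}

/-! ### The light cone on lists -/

/-- **One backward step of the cone on lists** (the machine's dispatch on the gate symbol): a
one-wire gate is kept iff its wire is in the cone (the cone is unchanged); a `CNOT` is kept iff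
one of its wires is in the cone, the other wire being added if missing; oracle gates (absent from
the families considered) are dropped. [folklore] -/
def coneStep : QGate cliffordT N → List (Fin N) × List (QGate cliffordT N) → List (Fin N) × List (QGate cliffordT N)
  | .gate .H e, (S, cc) => if embH e 0 ∈ S then (S, QGate.gate CliffordTOp.H e :: cc) else (S, cc)
  | .gate .S e, (S, cc) => if embS e 0 ∈ S then (S, QGate.gate CliffordTOp.S e :: cc) else (S, cc)
  | .gate .T e, (S, cc) => if embT e 0 ∈ S then (S, QGate.gate CliffordTOp.T e :: cc) else (S, cc)
  | .gate .CNOT e, (S, cc) =>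
      if embC e 0 ∈ S then
        (if embC e 1 ∈ S then (S, QGate.gate CliffordTOp.CNOT e :: cc)
         else (embC e 1 :: S, QGate.gate CliffordTOp.CNOT e :: cc))
      else
        (if embC e 1 ∈ S then (embC e 0 :: S, QGate.gate CliffordTOp.CNOT e :: cc) else (S, cc))
  | .oracle _ _, (S, cc) => (S, cc)

/-- **The backward light cone on lists**: fold `coneStep` from the last gate. [folklore] -/
def coneL (gs : List (QGate cliffordT N)) (S₀ : List (Fin N)) : List (Fin N) × List (QGate cliffordT N) :=
  gs.foldr coneStep (S₀, [])

/-- `coneL` through a cons. [folklore] -/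
theorem coneL_cons (g : QGate cliffordT N) (gs : List (QGate cliffordT N)) (S₀ : List (Fin N)) :
    coneL (g :: gs) S₀ = coneStep g (coneL gs S₀) := rfl

/-- The wires of a placed one-wire gate. [folklore] -/
theorem wires_gate_one {op : CliffordTOp} (hop : cliffordT.arity op = 1)
    (e : Fin (cliffordT.arity op) ↪ Fin N) :
    (QGate.gate op e : QGate cliffordT N).wires = {e ⟨0, by omega⟩} := by
  ext l
  simp only [QGate.wires, Finset.mem_map, Finset.mem_univ, true_and, Finset.mem_singleton]
  constructor
  · rintro ⟨a, rfl⟩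
    congr 1; ext; have := a.isLt; omega
  · rintro rfl; exact ⟨_, rfl⟩

/-- The wires of a placed `CNOT`. [folklore] -/
theorem wires_gate_CNOT (e : Fin (cliffordT.arity CliffordTOp.CNOT) ↪ Fin N) :
    (QGate.gate CliffordTOp.CNOT e : QGate cliffordT N).wires = {embC e 0, embC e 1} := by
  ext l
  simp only [QGate.wires, Finset.mem_map, Finset.mem_univ, true_and, Finset.mem_insert,
    Finset.mem_singleton]
  constructor
  · rintro ⟨⟨a, ha⟩, rfl⟩
    have ha' : a < 2 := ha
    interval_cases a
    · left; rfl
    · right; rfl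
  · rintro (rfl | rfl)
    · exact ⟨(0 : Fin 2), rfl⟩
    · exact ⟨(1 : Fin 2), rfl⟩

/-- **`coneL` computes `cone`**: for an oracle-free gate list and a duplicate-free start, the kept
gates coincide, the wire list enumerates the cone without duplicates. [folklore] -/
theorem coneL_spec : ∀ (gs : List (QGate cliffordT N)) (S₀ : List (Fin N)),
    (∀ g ∈ gs, g.IsOracleFree) → S₀.Nodup →
      (coneL gs S₀).2 = (cone gs S₀.toFinset).2 ∧ (coneL gs S₀).1.toFinset = (cone gs S₀.toFinset).1 ∧
        (coneL gs S₀).1.Nodup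
  | [], S₀, _, hnd => ⟨rfl, rfl, hnd⟩
  | g :: gs, S₀, hfree, hnd => by
    classical
    obtain ⟨h2, h1, h3⟩ := coneL_spec gs S₀ (fun g' hg' => hfree g' (List.mem_cons_of_mem g hg')) hnd
    rw [coneL_cons]
    set L := coneL gs S₀ with hL
    obtain ⟨Sl, cc⟩ := L
    simp only at h1 h2 h3
    have hmem : ∀ i : Fin N, i ∈ Sl ↔ i ∈ (cone gs S₀.toFinset).1 := fun i => by
      rw [← h1, List.mem_toFinset]
    have hg := hfree g List.mem_cons_self
    -- one-wire gates
    have one_wire : ∀ (op : CliffordTOp) (hop : cliffordT.arity op = 1) (e : Fin (cliffordT.arity op) ↪ Fin N),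
        let i : Fin N := e ⟨0, by omega⟩
        ((if i ∈ Sl then (Sl, QGate.gate op e :: cc) else (Sl, cc)) : List (Fin N) × List (QGate cliffordT N)).2 =
            (cone (QGate.gate op e :: gs) S₀.toFinset).2 ∧
          ((if i ∈ Sl then (Sl, QGate.gate op e :: cc) else (Sl, cc)) : List (Fin N) × List (QGate cliffordT N)).1.toFinset =
            (cone (QGate.gate op e :: gs) S₀.toFinset).1 ∧
          ((if i ∈ Sl then (Sl, QGate.gate op e :: cc) else (Sl, cc)) : List (Fin N) × List (QGate cliffordT N)).1.Nodup := by
      intro op hop e i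
      have hw : (QGate.gate op e : QGate cliffordT N).wires = {i} := wires_gate_one hop e
      by_cases hi : i ∈ Sl
      · have hnd' : ¬ Disjoint (QGate.gate op e : QGate cliffordT N).wires (cone gs S₀.toFinset).1 := by
          rw [hw, Finset.disjoint_singleton_left]; exact fun h => h ((hmem i).1 hi)
        rw [if_pos hi, cone_cons_of_not_disjoint hnd', hw]
        refine ⟨by rw [h2], ?_, h3⟩
        rw [h1]; simp [(hmem i).1 hi]
      · have hd : Disjoint (QGate.gate op e : QGate cliffordT N).wires (cone gs S₀.toFinset).1 := by
          rw [hw, Finset.disjoint_singleton_left]; exact fun h => hi ((hmem i).2 h)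
        rw [if_neg hi, cone_cons_of_disjoint hd]
        exact ⟨h2, h1, h3⟩
    cases g with
    | oracle k e => exact absurd hg id
    | gate op e =>
      cases op with
      | H => exact one_wire _ rfl e
      | S => exact one_wire _ rfl e
      | T => exact one_wire _ rfl e
      | CNOT =>
        have hw := wires_gate_CNOT (N := N) e
        simp only [coneStep]
        by_cases hi : embC e 0 ∈ Sl <;> by_cases hj : embC e 1 ∈ Sl
        · have hnd' : ¬ Disjoint (QGate.gate CliffordTOp.CNOT e : QGate cliffordT N).wires (cone gs S₀.toFinset).1 := by
            rw [hw, Finset.not_disjoint_iff]; exact ⟨_, by simp, (hmem _).1 hi⟩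
          rw [if_pos hi, if_pos hj, cone_cons_of_not_disjoint hnd', hw]
          refine ⟨by rw [h2], ?_, h3⟩
          rw [h1]; ext l; simp only [Finset.mem_union, Finset.mem_insert, Finset.mem_singleton]
          constructor
          · intro h; exact Or.inl h
          · rintro (h | rfl | rfl)
            · exact h
            · exact (hmem _).1 hi
            · exact (hmem _).1 hj
        · have hnd' : ¬ Disjoint (QGate.gate CliffordTOp.CNOT e : QGate cliffordT N).wires (cone gs S₀.toFinset).1 := by
            rw [hw, Finset.not_disjoint_iff]; exact ⟨_, by simp, (hmem _).1 hi⟩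
          rw [if_pos hi, if_neg hj, cone_cons_of_not_disjoint hnd', hw]
          refine ⟨by rw [h2], ?_, List.nodup_cons.2 ⟨hj, h3⟩⟩
          rw [List.toFinset_cons, h1]; ext l
          simp only [Finset.mem_union, Finset.mem_insert, Finset.mem_singleton]
          constructor
          · rintro (rfl | h)
            · exact Or.inr (Or.inr rfl)
            · exact Or.inl h
          · rintro (h | rfl | rfl)
            · exact Or.inr h
            · exact Or.inr ((hmem _).1 hi)
            · exact Or.inl rfl
        · have hnd' : ¬ Disjoint (QGate.gate CliffordTOp.CNOT e : QGate cliffordT N).wires (cone gs S₀.toFinset).1 := by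
            rw [hw, Finset.not_disjoint_iff]; exact ⟨_, by simp, (hmem _).1 hj⟩
          rw [if_neg hi, if_pos hj, cone_cons_of_not_disjoint hnd', hw]
          refine ⟨by rw [h2], ?_, List.nodup_cons.2 ⟨hi, h3⟩⟩
          rw [List.toFinset_cons, h1]; ext l
          simp only [Finset.mem_union, Finset.mem_insert, Finset.mem_singleton]
          constructor
          · rintro (rfl | h)
            · exact Or.inr (Or.inl rfl)
            · exact Or.inl h
          · rintro (h | rfl | rfl)
            · exact Or.inr h
            · exact Or.inl rfl
            · exact Or.inr ((hmem _).1 hj)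
        · have hd : Disjoint (QGate.gate CliffordTOp.CNOT e : QGate cliffordT N).wires (cone gs S₀.toFinset).1 := by
            rw [hw, Finset.disjoint_insert_left, Finset.disjoint_singleton_left]
            exact ⟨fun h => hi ((hmem _).2 h), fun h => hj ((hmem _).2 h)⟩
          rw [if_neg hi, if_neg hj, cone_cons_of_disjoint hd]
          exact ⟨h2, h1, h3⟩

/-- The number of kept gates is at most the number of gates. [folklore] -/
theorem length_coneL_le {gs : List (QGate cliffordT N)} {S₀ : List (Fin N)}
    (hfree : ∀ g ∈ gs, g.IsOracleFree) (hnd : S₀.Nodup) : (coneL gs S₀).2.length ≤ gs.length := by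
  rw [(coneL_spec gs S₀ hfree hnd).1]; exact length_cone_le gs _

/-! ### The sign analysis -/

/-- **The integer test.** If `A + √2 B = 2^h p` and `A − √2 B = 2^h p'` with `p' ∈ [0, 1]`, then
`W = 10A + 14B − 5·2^h` is positive when `p ≥ 2/3` and negative when `p ≤ 1/3`:
`√2 W = 2^h ((5√2 + 7) p + (5√2 − 7) p' − 5√2)` with `0 < 5√2 − 7 < 1/2`.
(Adleman–DeMarrais–Huang 1997, §6 Lemma 6.10: rational tests for `ℤ[√2]/2^h` probabilities.)
[folklore] -/
theorem decision_sign {A B : ℤ} {h : ℕ} {P P' : ℝ}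
    (hP : (A : ℝ) + Real.sqrt 2 * B = 2 ^ h * P) (hP' : (A : ℝ) - Real.sqrt 2 * B = 2 ^ h * P')
    (h0 : 0 ≤ P') (h1 : P' ≤ 1) :
    (2 / 3 ≤ P → 0 < 10 * A + 14 * B - 5 * 2 ^ h) ∧ (P ≤ 1 / 3 → 10 * A + 14 * B - 5 * 2 ^ h < 0) := by
  set s := Real.sqrt 2 with hs
  have hsl := sqrt_two_gt
  have hsu := sqrt_two_lt
  have hM : (0 : ℝ) < (2 : ℝ) ^ h := by positivity
  set M := (2 : ℝ) ^ h with hMdef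
  have ha : (A : ℝ) = M * (P + P') / 2 := by linarith
  have hb : s * (B : ℝ) = M * (P - P') / 2 := by linarith
  -- `s · W = M · E` with `E = 5 s (P + P' − 1) + 7 (P − P')`
  have key : s * ((10 * A + 14 * B - 5 * 2 ^ h : ℤ) : ℝ) = M * (5 * s * (P + P' - 1) + 7 * (P - P')) := by
    push_cast
    rw [← hMdef]
    have : s * (10 * (A : ℝ) + 14 * B - 5 * M) = 10 * s * A + 14 * (s * B) - 5 * s * M := by ring
    rw [this, hb, ha]; ring
  have hs0 : (0 : ℝ) < s := by linarith
  have hc : (0 : ℝ) ≤ 5 * s - 7 := by linarith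
  constructor
  · intro hp
    have hE : 0 < 5 * s * (P + P' - 1) + 7 * (P - P') := by
      have e1 : 0 ≤ (5 * s - 7) * P' := mul_nonneg hc h0
      nlinarith
    have hpos : 0 < s * ((10 * A + 14 * B - 5 * 2 ^ h : ℤ) : ℝ) := by rw [key]; exact mul_pos hM hE
    exact_mod_cast (pos_of_mul_pos_right hpos hs0.le)
  · intro hp
    have hE : 5 * s * (P + P' - 1) + 7 * (P - P') < 0 := by
      have e1 : (5 * s - 7) * P' ≤ (5 * s - 7) * 1 := mul_le_mul_of_nonneg_left h1 hc
      nlinarith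
    have hneg : s * ((10 * A + 14 * B - 5 * 2 ^ h : ℤ) : ℝ) < 0 := by rw [key]; exact mul_neg_of_pos_of_neg hM hE
    exact_mod_cast (neg_of_mul_neg_right hneg hs0.le)

/-! ### The test of a family on an input -/

section Family

variable (F : QCircuitFamily cliffordT) (x : List Bool)

/-- The padded input label `x 0^m` of the `|x|`-th circuit. [folklore] -/
def baseLabel : QReg (x.length + F.ancillas x.length) := padInput x.get (F.ancillas x.length)

/-- The cone data of wire `0` of the `|x|`-th circuit: wire list and kept gates. [folklore] -/
def coneData (hN : 0 < x.length + F.ancillas x.length) :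
    List (Fin (x.length + F.ancillas x.length)) × List (QGate cliffordT (x.length + F.ancillas x.length)) :=
  coneL (F.circ x.length).gates [⟨0, hN⟩]

/-- The final sparse state of the simulation of the cone of wire `0` on `|x 0^m⟩`. [folklore] -/
def finalState (hN : 0 < x.length + F.ancillas x.length) :
    List (QReg (x.length + F.ancillas x.length) × Amp) :=
  runGates (coneData F x hN).2 (initState (coneData F x hN).1 (baseLabel F x))

/-- **The integer test** `W = 10A + 14B − 5·2^h` of the input `x` (`h` = Hadamard count of the
kept gates, `(A, B)` the read-out sums of the final state). [folklore] -/
def decisionW (hN : 0 < x.length + F.ancillas x.length) : ℤ :=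
  10 * (sums (finalState F x hN)).1 + 14 * (sums (finalState F x hN)).2 - 5 * 2 ^ hCount (coneData F x hN).2

variable {F x}

/-- The acceptance probability of an oracle-free family is `probAcc ω` of the kept gates of the
cone of wire `0` (cone invariance, then `prodZeta_omega`). [folklore] -/
theorem acceptProbOn_eq_probAcc_cone (hfree : F.IsOracleFree) (hN : 0 < x.length + F.ancillas x.length) :
    F.acceptProbOn 0 x = probAcc omega (coneData F x hN).2 (baseLabel F x) hN := by
  have hspec := coneL_spec (F.circ x.length).gates [⟨0, hN⟩] (hfree x.length) (List.nodup_singleton _)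
  set cc := (cone (F.circ x.length).gates {(⟨0, hN⟩ : Fin (x.length + F.ancillas x.length))}).2 with hcc
  have hcf : (⟨cc⟩ : QCircuit cliffordT (x.length + F.ancillas x.length)).IsOracleFree := fun g hg =>
    hfree x.length g (mem_of_mem_cone hg)
  rw [QCircuitFamily.acceptProbOn, acceptProb_eq_acceptProb_cone cliffordT_isUnitary_holds 0 _ _ hN,
    coneData, hspec.1, List.toFinset_cons, List.toFinset_nil, insert_empty_eq, QCircuit.acceptProb, probAcc,
    ← hcc]
  refine Finset.sum_congr rfl fun y _ => ?_
  rw [dif_pos hN, QCircuit.runOn, ← prodZeta_omega 0 hcf]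
  rfl

/-- The simulation of the kept gates represents the `ζ`-semantics, for `ζ² = i`. [folklore] -/
theorem represents_finalState {ζ : ℂ} (hζ : ζ ^ 2 = Complex.I) (hfree : F.IsOracleFree)
    (hN : 0 < x.length + F.ancillas x.length) :
    Represents ζ (coneData F x hN).1.toFinset (baseLabel F x) (hCount (coneData F x hN).2)
      (finalState F x hN) (prodZeta ζ (coneData F x hN).2 *ᵥ basisState (baseLabel F x)) := by
  have hspec := coneL_spec (F.circ x.length).gates [⟨0, hN⟩] (hfree x.length) (List.nodup_singleton _)
  have h0 : Represents ζ (coneData F x hN).1.toFinset (baseLabel F x) 0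
      (initState (coneData F x hN).1 (baseLabel F x)) (basisState (baseLabel F x)) :=
    represents_initState ζ hspec.2.2 (baseLabel F x)
  have h2 : (coneData F x hN).2 = (cone (F.circ x.length).gates {⟨0, hN⟩}).2 := hspec.1
  have h1 : (coneData F x hN).1.toFinset = (cone (F.circ x.length).gates {⟨0, hN⟩}).1 := hspec.2.1
  have h := h0.runGates hζ (gs := (coneData F x hN).2)
    (fun g hg => hfree x.length g (mem_of_mem_cone (by rw [h2] at hg; exact hg)))
    (fun g hg => by
      rw [h1]
      rw [h2] at hg
      exact wires_subset_cone _ _ g hg)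
  simpa [finalState] using h

/-- **Soundness of the test, accepting side**: acceptance probability `≥ 2/3` gives `W > 0`.
(Markov–Shi 2008, Cor. 1.5, decision form.) [folklore] -/
theorem decisionW_pos (hfree : F.IsOracleFree) (hN : 0 < x.length + F.ancillas x.length)
    (hacc : 2 / 3 ≤ F.acceptProbOn 0 x) : 0 < decisionW F x hN := by
  have hω := (represents_finalState omega_pow_two hfree hN).two_pow_mul_probAcc hN (ε := 1)
    (fun a => by rw [Amp.normSq_eval_omega]; ring)
  have hω5 := (represents_finalState omega5_pow_two hfree hN).two_pow_mul_probAcc hN (ε := -1)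
    (fun a => by rw [Amp.normSq_eval_omega5]; ring)
  rw [acceptProbOn_eq_probAcc_cone hfree hN] at hacc
  have h := (decision_sign (A := (sums (finalState F x hN)).1) (B := (sums (finalState F x hN)).2)
    (h := hCount (coneData F x hN).2) (P := probAcc omega (coneData F x hN).2 (baseLabel F x) hN)
    (P' := probAcc (omega ^ 5) (coneData F x hN).2 (baseLabel F x) hN)
    (by rw [probAcc]; linarith [hω]) (by rw [probAcc]; linarith [hω5])
    (probAcc_nonneg _ _ hN) (probAcc_le_one omega5_mul_star _ _ hN)).1 hacc
  unfold decisionW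
  exact_mod_cast h

/-- **Soundness of the test, rejecting side**: acceptance probability `≤ 1/3` gives `W < 0`.
(Markov–Shi 2008, Cor. 1.5, decision form.) [folklore] -/
theorem decisionW_neg (hfree : F.IsOracleFree) (hN : 0 < x.length + F.ancillas x.length)
    (hrej : F.acceptProbOn 0 x ≤ 1 / 3) : decisionW F x hN < 0 := by
  have hω := (represents_finalState omega_pow_two hfree hN).two_pow_mul_probAcc hN (ε := 1)
    (fun a => by rw [Amp.normSq_eval_omega]; ring)
  have hω5 := (represents_finalState omega5_pow_two hfree hN).two_pow_mul_probAcc hN (ε := -1)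
    (fun a => by rw [Amp.normSq_eval_omega5]; ring)
  rw [acceptProbOn_eq_probAcc_cone hfree hN] at hrej
  have h := (decision_sign (A := (sums (finalState F x hN)).1) (B := (sums (finalState F x hN)).2)
    (h := hCount (coneData F x hN).2) (P := probAcc omega (coneData F x hN).2 (baseLabel F x) hN)
    (P' := probAcc (omega ^ 5) (coneData F x hN).2 (baseLabel F x) hN)
    (by rw [probAcc]; linarith [hω]) (by rw [probAcc]; linarith [hω5])
    (probAcc_nonneg _ _ hN) (probAcc_le_one omega5_mul_star _ _ hN)).2 hrej
  unfold decisionW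
  exact_mod_cast h

/-- **The test decides a gap language** (pointwise): under the `(2/3, 1/3)` promise for `x`,
`W > 0 ↔ x ∈ L`. [folklore] -/
theorem decisionW_pos_iff (hfree : F.IsOracleFree) (hN : 0 < x.length + F.ancillas x.length)
    {L : Language Bool} (hgap : (x ∈ L → 2 / 3 ≤ F.acceptProbOn 0 x) ∧ (x ∉ L → F.acceptProbOn 0 x ≤ 1 / 3)) :
    0 < decisionW F x hN ↔ x ∈ L := by
  constructor
  · intro hW
    by_contra hx
    exact absurd hW (not_lt.2 (decisionW_neg hfree hN (hgap.2 hx)).le)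
  · intro hx
    exact decisionW_pos hfree hN (hgap.1 hx)

/-- **Size of the simulation**: the final state has `2^{|S|}` entries, `S` the cone wire list.
[folklore] -/
theorem length_finalState (hN : 0 < x.length + F.ancillas x.length) :
    (finalState F x hN).length = 2 ^ (coneData F x hN).1.length := by
  rw [finalState, length_runGates, length_initState]

/-- **Width of the cone of a local shallow circuit** (list form): if the `|x|`-th circuit is
`q`-local under an ordering `σ`, the cone wire list has at most `2 q · depth + 1` entries.
(Markov–Shi 2008, §5, "`r = O(qD)`".) [folklore] -/
theorem length_coneData_le (hfree : F.IsOracleFree) (hN : 0 < x.length + F.ancillas x.length)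
    (σ : Fin (x.length + F.ancillas x.length) ≃ Fin (x.length + F.ancillas x.length)) (q : ℕ)
    (hloc : ∀ g ∈ (F.circ x.length).gates, ∀ i ∈ g.wires, ∀ j ∈ g.wires,
      ((σ i : Fin _) : ℕ) ≤ ((σ j : Fin _) : ℕ) + q) :
    (coneData F x hN).1.length ≤ 2 * (q * (F.circ x.length).depth) + 1 := by
  have hspec := coneL_spec (F.circ x.length).gates [⟨0, hN⟩] (hfree x.length) (List.nodup_singleton _)
  rw [coneData, ← List.toFinset_card_of_nodup hspec.2.2, hspec.2.1, List.toFinset_cons, List.toFinset_nil,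
    insert_empty_eq]
  exact card_cone_le σ q (F.circ x.length) hloc ⟨0, hN⟩

end Family

end LightCone

end Literature.Computability.QuantumComplexity

end
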